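import Summits.Ventures.YMGap.Census.WindowRows
import HarnessLib

/-!
# Venture YMGap, track (b) — integrating the interior HORIZONTAL links of a decimation window:
# the ladder of `b` rectangles merges into the coarse plaquette (Migdal's recursion, exactly)

HONEST FRAMING: venture file of the cell `pub-ymgap` (QuantumFields programme), track (b); exact character calculus on
finite tori for the exactness half of Tomboulis's Prop. III.1 (arXiv:0707.2179 §2.1 (RG2)–(RG3)).  Nothing here concerns
(5.15), limits, confinement or a mass gap.

After `WindowRows` the window of the coarse plaquette `P` is a ladder of `b` rectangles
`Σ_m A'_m χ_m(H_t v_{b,t} H_{t+1}⁻¹ v_{0,t}⁻¹)`, `A'_m = A_m^b/(m+1)^{b-1}`, `H_t = h_{0,t}⋯h_{b-1,t}` (`rowMerged`).  Read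
backwards (`χ(g⁻¹) = χ(g)`), rectangle `t` is the `RowMerge` face `χ(v_{0,t} · H_{t+1} · v_{b,t}⁻¹ · H_t⁻¹)` with rung
`H_t = h_{0,t} · (h_{1,t}⋯h_{b-1,t})` = merge link `h_{0,t}` times a companion (`ladA`, `ladB`, `ladE`, `ladR`;
`rowMerged_eq_faceW_lad`).  The merge links `h_{0,k}`, `1 ≤ k ≤ b-1`, are interior, so `RowMerge` merges the ladder into
the single coarse face `Σ_m A_m^{b²}/(m+1)^{b²-1} χ_m(H_0 V_b H_b⁻¹ V_0⁻¹)` (`mergedFace`, `cellCoef`, `coarseWord`;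
`V_s = v_{s,0}⋯v_{s,b-1}`): **`integral_windowProd_mul`** — the `2b(b-1)` interior integrations of one window are exact
in the presence of any continuous spectator not reading the interior links.

References: E. T. Tomboulis, arXiv:0707.2179 §2.1 [cite: Tomboulis2007Confinement, §2.1 (RG2)–(RG3)]; A. A. Migdal,
Sov. Phys. JETP 42 (1975) 413 [folklore].
-/

noncomputable section

open MeasureTheory Finset Real Function
open scoped BigOperators
open Literature.MathematicalPhysics.QuantumLattice
open Literature.MathematicalPhysics.QuantumFieldTheory
open Literature.MathematicalPhysics.QuantumFieldTheory.Tomboulis2007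
open Summit.Ventures.LatticeQCDFlow.Exactness
open Summit.Ventures.LatticeQCDFlow.Scoring

namespace Summit.Ventures.YMGap.Census

variable {d L : ℕ} (b : ℕ)

/-! ### Row and column words of a window -/

/-- `H_t = h_{0,t} h_{1,t} ⋯ h_{b-1,t}` (ordered product of the horizontal links of the window at height `t`). -/
def hRow (P : Plaquette d L) (t : ℕ) (W : GaugeConfig d (b * L) SU2) : SU2 := prodA (rowA b P t) (b - 1) W

/-- `V_s = v_{s,0} v_{s,1} ⋯ v_{s,b-1}` (ordered product of the vertical links of the window at position `s`). -/
def vCol (P : Plaquette d L) (s : ℕ) (W : GaugeConfig d (b * L) SU2) : SU2 :=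
  prodA (fun t W => W (vLink b P s t)) (b - 1) W

/-- Ladder face data `a_t = U(v_{0,t})`. -/
def ladA (P : Plaquette d L) (t : ℕ) (W : GaugeConfig d (b * L) SU2) : SU2 := W (vLink b P 0 t)

/-- Ladder face data `b_t = U(v_{b,t})⁻¹`. -/
def ladB (P : Plaquette d L) (t : ℕ) (W : GaugeConfig d (b * L) SU2) : SU2 := (W (vLink b P b t))⁻¹

/-- Ladder rungs: the merge links `h_{0,t}`. -/
def ladE (P : Plaquette d L) (t : ℕ) : Edge d (b * L) := hLink b P 0 t

/-- Ladder companions `h_{1,t} ⋯ h_{b-1,t}`. -/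
def ladR (P : Plaquette d L) (t : ℕ) (W : GaugeConfig d (b * L) SU2) : SU2 :=
  ((List.range (b - 1)).map fun i => W (hLink b P (i + 1) t)).prod

/-- The coefficients of the merged window: `A_m ↦ (A_m^b/(m+1)^{b-1})^b/(m+1)^{b-1} = A_m^{b²}/(m+1)^{b²-1}`. -/
def cellCoef (A : ℕ → ℝ) : ℕ → ℝ := mergeCoef (mergeCoef A (b - 1)) (b - 1)

/-- The boundary word of the window: `H_0 V_b H_b⁻¹ V_0⁻¹` (the coarse plaquette holonomy in fine links). -/
def coarseWord (P : Plaquette d L) (W : GaugeConfig d (b * L) SU2) : SU2 :=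
  hRow b P 0 W * vCol b P b W * (hRow b P b W)⁻¹ * (vCol b P 0 W)⁻¹

/-- **The merged window**: `Σ_m A_m^{b²}/(m+1)^{b²-1} χ_m(H_0 V_b H_b⁻¹ V_0⁻¹)`. -/
def mergedFace (K : ℕ) (A : ℕ → ℝ) (P : Plaquette d L) (W : GaugeConfig d (b * L) SU2) : ℝ :=
  faceSum K (cellCoef b A) (coarseWord b P W)

variable {b}
variable [NeZero b] [NeZero L]

omit [NeZero L] in
/-- `b - 1 + 1 = b`. -/
theorem sub_one_add_one_b : b - 1 + 1 = b := Nat.sub_add_cancel (Nat.one_le_iff_ne_zero.2 (NeZero.ne b))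

omit [NeZero b] [NeZero L] in
/-- `χ`-sums do not see inversion: `faceSum K A g⁻¹ = faceSum K A g`. -/
theorem faceSum_inv' (K : ℕ) (A : ℕ → ℝ) (g : SU2) : faceSum K A g⁻¹ = faceSum K A g :=
  faceSum_congr_su2a0 K A (su2a0_inv g)

omit [NeZero b] [NeZero L] in
/-- The ladder rung is the row word: `h_{0,t} · (h_{1,t}⋯h_{b-1,t}) = H_t`. -/
theorem rungW_lad (P : Plaquette d L) (t : ℕ) (W : GaugeConfig d (b * L) SU2) :
    rungW (ladE b P) (ladR b P) t W = hRow b P t W := by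
  unfold rungW ladE ladR hRow prodA rowA
  rw [List.range_succ_eq_map, List.map_cons, List.prod_cons, List.map_map]
  rfl

omit [NeZero b] [NeZero L] in
/-- A reversed product of inverses is the inverse of the product. -/
theorem prodB_inv_eq (a : ℕ → GaugeConfig d (b * L) SU2 → SU2) (k : ℕ) (W : GaugeConfig d (b * L) SU2) :
    prodB (fun i W => (a i W)⁻¹) k W = (prodA a k W)⁻¹ := by
  unfold prodB prodA
  rw [List.prod_inv_reverse, List.map_map]
  rfl

omit [NeZero b] [NeZero L] in
/-- `b_{b-1}⋯b_0 = H_{t+1}⁻¹` for the row data. -/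
theorem prodB_rowB (P : Plaquette d L) (t : ℕ) (W : GaugeConfig d (b * L) SU2) :
    prodB (rowB b P t) (b - 1) W = (hRow b P (t + 1) W)⁻¹ :=
  prodB_inv_eq (fun i W => W (hLink b P i (t + 1))) (b - 1) W

omit [NeZero b] [NeZero L] in
/-- `b_{b-1}⋯b_0 = V_b⁻¹` for the ladder data. -/
theorem prodB_ladB (P : Plaquette d L) (W : GaugeConfig d (b * L) SU2) :
    prodB (ladB b P) (b - 1) W = (vCol b P b W)⁻¹ :=
  prodB_inv_eq (fun t W => W (vLink b P b t)) (b - 1) W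

omit [NeZero L] in
/-- The merged row as a `χ`-sum of its rectangle word `H_t v_{b,t} H_{t+1}⁻¹ v_{0,t}⁻¹`. -/
theorem rowMerged_eq_faceSum (K : ℕ) (A : ℕ → ℝ) (P : Plaquette d L) (t : ℕ) (W : GaugeConfig d (b * L) SU2) :
    rowMerged b K A P t W = faceSum K (mergeCoef A (b - 1))
      (hRow b P t W * W (vLink b P b t) * (hRow b P (t + 1) W)⁻¹ * (W (vLink b P 0 t))⁻¹) := by
  unfold rowMerged rowState
  rw [prodB_rowB]
  simp only [rungW, rowE, oneR, mul_one, sub_one_add_one_b]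
  rfl

omit [NeZero b] [NeZero L] in
/-- The ladder face `t` as a `χ`-sum of the reversed rectangle word. -/
theorem faceW_lad (K : ℕ) (A' : ℕ → ℝ) (P : Plaquette d L) (t : ℕ) (W : GaugeConfig d (b * L) SU2) :
    faceW K A' (ladA b P) (ladB b P) (ladE b P) (ladR b P) t W =
      faceSum K A' (W (vLink b P 0 t) * hRow b P (t + 1) W * (W (vLink b P b t))⁻¹ * (hRow b P t W)⁻¹) := by
  unfold faceW
  rw [rungW_lad, rungW_lad]
  rfl

omit [NeZero L] in
/-- **The merged rows are the faces of the ladder** (read backwards). -/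
theorem rowMerged_eq_faceW_lad (K : ℕ) (A : ℕ → ℝ) (P : Plaquette d L) (t : ℕ) (W : GaugeConfig d (b * L) SU2) :
    rowMerged b K A P t W = faceW K (mergeCoef A (b - 1)) (ladA b P) (ladB b P) (ladE b P) (ladR b P) t W := by
  rw [rowMerged_eq_faceSum, faceW_lad, ← faceSum_inv' K _ (W (vLink b P 0 t) * _ * _ * _)]
  congr 1
  simp only [mul_inv_rev, inv_inv, mul_assoc]

omit [NeZero L] in
/-- The final row state of the ladder is the merged window. -/
theorem rowState_lad_eq_mergedFace (K : ℕ) (A : ℕ → ℝ) (P : Plaquette d L) (W : GaugeConfig d (b * L) SU2) :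
    rowState K (mergeCoef A (b - 1)) (ladA b P) (ladB b P) (ladE b P) (ladR b P) (b - 1) W = mergedFace b K A P W := by
  unfold rowState mergedFace coarseWord cellCoef
  rw [prodB_ladB, sub_one_add_one_b, rungW_lad, rungW_lad, ← faceSum_inv' K _ (hRow b P 0 W * _ * _ * _)]
  congr 1
  simp only [mul_inv_rev, inv_inv, mul_assoc]
  rfl

/-! ### Continuity -/

omit [NeZero b] [NeZero L] in
/-- `ladR` is continuous. -/
theorem continuous_ladR (P : Plaquette d L) (t : ℕ) : Continuous (ladR b P t) := by
  unfold ladR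
  exact continuous_list_prod _ fun i _ => continuous_apply _

omit [NeZero L] in
/-- `mergedFace` is continuous. -/
theorem continuous_mergedFace (K : ℕ) (A : ℕ → ℝ) (P : Plaquette d L) : Continuous (mergedFace b K A P) := by
  have h : mergedFace b K A P = fun W =>
      rowState K (mergeCoef A (b - 1)) (ladA b P) (ladB b P) (ladE b P) (ladR b P) (b - 1) W :=
    funext fun W => (rowState_lad_eq_mergedFace K A P W).symm
  rw [h]
  unfold rowState
  exact (continuous_faceSum K _).comp
    ((((continuous_prodA (fun t => continuous_apply _) _).mul
      (continuous_rungW _ (continuous_ladR P) _)).mul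
      (continuous_prodB (fun t => (continuous_apply _).inv) _)).mul (continuous_rungW _ (continuous_ladR P) _).inv)

/-! ### Merging the ladder -/

/-- **Merging the ladder**: with a continuous spectator `Q` not reading the interior horizontal links `h_{s,k}`
(`s < b`, `1 ≤ k < b`), `∫ (∏_t rowMerged_t) · Q = ∫ mergedFace · Q`. -/
theorem integral_ladder_mul (K : ℕ) (A : ℕ → ℝ) (P : Plaquette d L) {Q : GaugeConfig d (b * L) SU2 → ℝ}
    (hQh : ∀ s k, s < b → 1 ≤ k → k < b → ∀ W g, Q (update W (hLink b P s k) g) = Q W) (hQc : Continuous Q) :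
    ∫ W, (∏ t ∈ Finset.range b, rowMerged b K A P t W) * Q W ∂(Measure.pi fun _ : Edge d (b * L) => haarProbability SU2) =
      ∫ W, mergedFace b K A P W * Q W ∂(Measure.pi fun _ : Edge d (b * L) => haarProbability SU2) := by
  have hb : 1 ≤ b := Nat.one_le_iff_ne_zero.2 (NeZero.ne b)
  simp_rw [rowMerged_eq_faceW_lad, ← rowState_lad_eq_mergedFace]
  refine integral_prod_faceW_eq_rowState K (mergeCoef A (b - 1)) hb ?_ ?_ ?_ ?_ ?_
    (fun t => continuous_apply _) (fun t => (continuous_apply _).inv) (continuous_ladR P) hQc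
  · intro k _ _ i U g
    exact update_of_ne (hLink_ne_vLink P 0 k 0 i).symm _ _
  · intro k _ _ i U g
    simp only [ladB, ladE, update_of_ne (hLink_ne_vLink P 0 k b i).symm]
  · intro k _ hkb j U g
    unfold ladR ladE
    congr 1
    refine List.map_congr_left fun i hi => update_of_ne ?_ _ _
    have hib : i + 1 < b := by have := List.mem_range.1 hi; omega
    refine hLink_ne_hLink_of_fst_mod_ne P j k ?_
    rw [Nat.mod_eq_of_lt hib, Nat.zero_mod]
    omega
  · intro k hk1 hkb U g
    exact hQh 0 k (by omega) hk1 (by omega) U g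
  · intro k hk1 hkb j hj hjk
    exact hLink_ne_hLink_of_mod_ne P 0 0 fun h => hjk (eq_of_mod_eq_of_interior hj hk1 (by omega) h)

/-- **One window integrates exactly** (arXiv:0707.2179 §2.1: the `2`-dimensional integrations inside one `b × b` cell;
Migdal's recursion): with a continuous spectator `Q` reading no interior link of the window of `P`,
`∫ (∏_{s,t<b} Σ_m A_m χ_m(U_{(s,t)})) · Q = ∫ (Σ_m A_m^{b²}/(m+1)^{b²-1} χ_m(H_0 V_b H_b⁻¹ V_0⁻¹)) · Q`. -/
theorem integral_windowProd_mul (K : ℕ) (A : ℕ → ℝ) (P : Plaquette d L) {Q : GaugeConfig d (b * L) SU2 → ℝ}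
    (hQv : ∀ k t, 1 ≤ k → k < b → t < b → ∀ W g, Q (update W (vLink b P k t) g) = Q W)
    (hQh : ∀ s k, s < b → 1 ≤ k → k < b → ∀ W g, Q (update W (hLink b P s k) g) = Q W) (hQc : Continuous Q) :
    ∫ W, windowProd b K A P W * Q W ∂(Measure.pi fun _ : Edge d (b * L) => haarProbability SU2) =
      ∫ W, mergedFace b K A P W * Q W ∂(Measure.pi fun _ : Edge d (b * L) => haarProbability SU2) := by
  rw [integral_windowProd_rows K A P hQv hQc, integral_ladder_mul K A P hQh hQc]

/-! ### What the merged window reads -/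

omit [NeZero L] in
/-- The merged window ignores updates at a link that is none of the boundary links it reads. -/
theorem mergedFace_update (K : ℕ) (A : ℕ → ℝ) (P : Plaquette d L) {E : Edge d (b * L)}
    (hh : ∀ s t', s < b → t' ≤ b → hLink b P s t' ≠ E) (hv : ∀ s' t', s' ≤ b → t' < b → vLink b P s' t' ≠ E)
    (W : GaugeConfig d (b * L) SU2) (g : SU2) : mergedFace b K A P (update W E g) = mergedFace b K A P W := by
  have hb : 1 ≤ b := Nat.one_le_iff_ne_zero.2 (NeZero.ne b)
  have hH : ∀ t', t' ≤ b → hRow b P t' (update W E g) = hRow b P t' W := fun t' ht' =>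
    prodA_update_le (fun i hi U g' => update_of_ne (hh i t' (by omega) ht') _ _) W g
  have hV : ∀ s', s' ≤ b → vCol b P s' (update W E g) = vCol b P s' W := fun s' hs' =>
    prodA_update_le (fun i hi U g' => update_of_ne (hv s' i hs' (by omega)) _ _) W g
  simp only [mergedFace, coarseWord, hH 0 (Nat.zero_le _), hH b le_rfl, hV 0 (Nat.zero_le _), hV b le_rfl]

omit [NeZero b] [NeZero L] in
/-- The window product ignores updates at a link that is none of the window links it reads. -/
theorem windowProd_update (K : ℕ) (A : ℕ → ℝ) (P : Plaquette d L) {E : Edge d (b * L)}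
    (hh : ∀ s t', s < b → t' ≤ b → hLink b P s t' ≠ E) (hv : ∀ s' t', s' ≤ b → t' < b → vLink b P s' t' ≠ E)
    (W : GaugeConfig d (b * L) SU2) (g : SU2) : windowProd b K A P (update W E g) = windowProd b K A P W := by
  refine Finset.prod_congr rfl fun t ht => ?_
  have htb := Finset.mem_range.1 ht
  exact rowProd_update K A P t (fun s hs => hh s t hs htb.le) (fun s hs => hh s (t + 1) hs (by omega))
    (fun s' hs' => hv s' t hs' htb) W g

end Summit.Ventures.YMGap.Census

end
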